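import Mathlib.RepresentationTheory.Invariants
import Mathlib.GroupTheory.FreeGroup.Basic
import Mathlib.LinearAlgebra.Quotient.Basic
import Mathlib.LinearAlgebra.Pi
import Mathlib.LinearAlgebra.FiniteDimensional.Lemmas
import Mathlib.Algebra.BigOperators.Fin
import Mathlib.Algebra.BigOperators.Intervals
import Mathlib.RepresentationTheory.Irreducible
import Literature.AlgebraicGeometry.Motives.LocalSystems
import HarnessLib

/-!
# Katz's middle convolution `MC_λ`: the Dettweiler–Reiter linear-algebra model

Katz (*Rigid Local Systems*, 1996, Ch. 2, §5.1) defines, for a local system `𝓥` on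
`U = 𝔸¹ ∖ {t₁,…,t_r}` and a non-trivial Kummer sheaf `𝓛_χ`, the **middle convolution** `MC_χ(𝓥)`,
a local system on `U` whose stalk at `y` is the parabolic cohomology `H¹(ℙ¹, j_*(𝓥 ⊗ 𝓛_χ(y - x)))`.
Dettweiler–Reiter gave a purely algebraic model on monodromy tuples [DettweilerReiter2000] and
proved it IS Katz's functor under the dictionary "local system on `U` ↔ module over the free group
`F_r = π₁(U, x₀)` on the standard generators" ([DettweilerReiter2007, Thm. 1.1]:
`MC_λ(𝓥) ≅ R¹(p̄₂)_*(j_*(p₁^*𝓥 ⊗ q^*𝓛_λ))`; row-vector version and the identification of the stalk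
with parabolic cohomology: [Dettweiler2008MC, §1.6, Lemma 1.9, Thm. 1.10]).  This file formalises
that model verbatim, in the convention of [DettweilerReiter2007, §2.1, Definition 2.1]:

* `MiddleConvolution.convolutionEnd A λ k = B_k ∈ End(V^ι)` for a tuple `A = (A_i)_{i ∈ ι}` of
  endomorphisms (`ι` a finite linear order, `Fin r` in the sources): the identity outside the `k`-th
  block row, which is `(λ(A_j - 1))_{j<k}, λA_k, (A_j - 1)_{j>k}` (`convolutionEnd_apply`).
* `MiddleConvolution.convolution ρ λ = C_λ(ρ)`: for a representation `ρ` of `FreeGroup ι` on `V`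
  (`A_i = ρ(f_i)`) and a unit `λ` the `B_k` are units (`convolutionUnit`, explicit inverse
  `convolutionInv`), and `F_ι` acts on `V^ι = ι → V` by `f_k ↦ B_k` (Def. 2.1 i).
* `fixedVectors ρ = 𝒦 = ⊕_k ker(A_k - 1)` (in the `k`-th slot), `ℒ = ⋂_k ker(B_k - 1)` = the
  invariants of `C_λ(ρ)` (`mem_invariants_convolution_iff`); both are `C_λ(ρ)`-stable, and
  `middleConvolution ρ λ = MC_λ(ρ)` is the induced representation on
  `MiddleConvolution.Space ρ λ = V^ι ⧸ (𝒦 + ℒ)` (Def. 2.1 ii).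
* `LocalSystem.middleConvolution`: for a local system `𝓥` on `S` (tree notion
  `LocalSystem K S = Π₁(S) ⥤ ModuleCat K`), a base point `s` and an ordered family of loops
  `γ : ι → π₁(S, s)`, `MC_λ` of the **monodromy tuple** `(ρ_𝓥(γ_i))_i` ([Dettweiler2008MC,
  Def. 1.1]); for `S = ℂ ∖ {t₁,…,t_r}` and the standard generators this is the monodromy of Katz's
  `MC_χ(𝓥)`, `χ(generator) = λ` ([DettweilerReiter2007, Thm. 1.1], [Dettweiler2008MC, Thm. 1.10]).

## Results (proved)
* Functoriality [DettweilerReiter2007, §2.2, Prop. 2.2]: `MiddleConvolution.convolutionMap`,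
  `MiddleConvolution.map` (`MC_λ` on morphisms of `F_ι`-modules), `map_id`, `map_comp`, `map_add`.
* `fixedVectors_inf_invariants_eq_bot`: `𝒦 ∩ ℒ = 0` when `λ - 1` is a unit ("`𝒦 + ℒ = 𝒦 ⊕ ℒ` if
  `λ ≠ 1`"); `mem_invariants_convolution_iff_eq_suffixVec`, `invariantsEquivKer`:
  `ℒ = {(A₂⋯A_r v, …, A_r v, v) | v ∈ ker(λ A₁⋯A_r - 1)} ≅ ker(λ A₁⋯A_r - 1)` ([DettweilerReiter2007,
  §2.1]), via the defects `D_k = (B_k w)_k - w_k` and `D_k - D_{k+1} = (λ - 1)(w_k - A_{k+1} w_{k+1})`.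
* **The rank formula** [DettweilerReiter2007, Thm. 2.4 (i)] (= [DettweilerReiter2000, Lemma 2.7];
  Katz [Katz1996, Cor. 3.3.6]): `finrank_middleConvolution_add_finrank`, for `λ ≠ 1` over a field,
  `dim MC_λ(V) + dim V = Σ_k rk(A_k - 1) + rk(λ·A₁⋯A_r - 1)` (the printed
  `dim MC_λ(V) = Σ_k rk(A_k - 1) - (dim V - rk(λ·A₁⋯A_r - 1))` without truncated subtraction).

## Named facts (statement only, cited)
`DettweilerReiter2007_mul` (Thm. 2.4 (ii): `MC_{λ₂} ∘ MC_{λ₁} ≅ MC_{λ₁λ₂}` under `(*)`, `(**)` =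
`CondStar`, `CondStarStar`, Def. 2.3).

**Retired (refuted as stated, no longer literature debt):** `DettweilerReiter2007_irreducible`, the
first vendored form of Thm. 2.4 (iii) ("`MC_λ` preserves irreducibility under `(*)`, `(**)`"), was
quantified over ALL numbers of generators `r : ℕ` and is FALSE for `r = 0` (the conditions are then
vacuous and `MC_λ` of the irreducible `1`-dimensional module of `F_0 = 1` is `0`): refuted in tree by
`not_DettweilerReiter2007_irreducible`; the source has `r ≥ 1` throughout (§2.1: "the free group `F_r`
on `r` generators `f_1, …, f_r`").  The statement with `0 < r` is the named fact
`DettweilerReiter2007_irreducible_pos`, DISCHARGED by `DettweilerReiter2007_irreducible_pos_holds` from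
the theorem `MiddleConvolution.isIrreducible_middleConvolution` — all three in
`Literature.AlgebraicGeometry.Motives.MiddleConvolutionProofs`.  The old def is kept only as the
`@[deprecated]` target of its refutation.
NOT here: braid compatibility and invariant forms (Thm. 2.4 (iv)–(vi)), Katz's existence algorithm
for rigid tuples [Katz1996, Thm. 5.2.1] / [DettweilerReiter2000, §4], and the motivic description
[Katz1996, Thm. 8.4.1] / [DettweilerReiter2007, Thm. 1.1] (needs `R¹(p̄₂)_* j_*`, absent from
Mathlib).  Mathlib has no `π₁(ℂ ∖ {t₁,…,t_r}) ≅ F_r`, so on local systems the functor is only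
available through a chosen homotopy basis `γ` (as in [Dettweiler2008MC, Def. 1.1]); general
convolutions `𝓥₁ ⋆ 𝓥₂` are not formalised.

## Conventions and Mathlib search
Column vectors and left actions as in [DettweilerReiter2007] (the transpose is [Dettweiler2008MC,
Lemma 1.9]); [DettweilerReiter2000] puts the factor `λ` on the blocks `j > k` instead
([DettweilerReiter2007, Remark after Def. 2.1]) — the two differ by reversing the order of `ι`.
`Representation` is a monoid hom into `Module.End` (product = composition), so `ρ(f₁f₂) = A₁ ∘ A₂`,
as for matrices acting on columns, and `ρ (prodGenerators r) = A₁ ∘ ⋯ ∘ A_r`.  No middle-convolution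
/ Pochhammer-tuple notion exists in Mathlib or the tree; used: `Representation.quotient`,
`Representation.invariants`, `Representation.IntertwiningMap`, `FreeGroup.lift`, `Submodule.pi`.
-/

noncomputable section

namespace Literature.AlgebraicGeometry.Motives

universe u

namespace MiddleConvolution

section Tuple

variable {K : Type*} [CommRing K] {V : Type*} [AddCommGroup V] [Module K V]
variable {ι : Type*} [Fintype ι] [LinearOrder ι]

/-- The off-diagonal block `(B_k)_{k,j}` (`j ≠ k`) of the Dettweiler–Reiter matrix `B_k`:
`λ (A_j - 1)` for `j < k` and `A_j - 1` for `j > k`.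
[cite: DettweilerReiter2007, §2.1 Definition 2.1] -/
def coeff (A : ι → Module.End K V) (c : K) (k j : ι) : Module.End K V :=
  if j < k then c • (A j - 1) else A j - 1

/-- The off-diagonal part of the `k`-th block row of `B_k`:
`v ↦ Σ_{j<k} λ(A_j - 1) v_j + Σ_{j>k} (A_j - 1) v_j`. [cite: DettweilerReiter2007, §2.1 Definition 2.1] -/
def offDiag (A : ι → Module.End K V) (c : K) (k : ι) : (ι → V) →ₗ[K] V :=
  ∑ j ∈ Finset.univ.erase k, coeff A c k j ∘ₗ LinearMap.proj j

/-- The `k`-th block row of `B_k`: `v ↦ λ A_k v_k + Σ_{j<k} λ(A_j - 1) v_j + Σ_{j>k} (A_j - 1) v_j`.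
[cite: DettweilerReiter2007, §2.1 Definition 2.1] -/
def row (A : ι → Module.End K V) (c : K) (k : ι) : (ι → V) →ₗ[K] V :=
  c • (A k ∘ₗ LinearMap.proj k) + offDiag A c k

/-- The Dettweiler–Reiter operator `B_k ∈ End(V^ι)` of the convolution `C_λ(A) = (B_k)_k`: the
identity outside the `k`-th block row, whose `k`-th block row is
`(λ(A_j - 1))_{j<k}, λ A_k, (A_j - 1)_{j>k}`. [cite: DettweilerReiter2007, §2.1 Definition 2.1] -/
def convolutionEnd (A : ι → Module.End K V) (c : K) (k : ι) : Module.End K (ι → V) :=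
  LinearMap.pi (Function.update (fun i => (LinearMap.proj i : (ι → V) →ₗ[K] V)) k (row A c k))

/-- Candidate inverse of `B_k` (it is the inverse when `A' = A_k⁻¹` and `c' = λ⁻¹`): the identity
outside the `k`-th block row, `v_k ↦ A' (c' (v_k - Σ_{j≠k} (B_k)_{kj} v_j))`. [folklore] -/
def convolutionInv (A : ι → Module.End K V) (c c' : K) (A' : Module.End K V) (k : ι) :
    Module.End K (ι → V) :=
  LinearMap.pi (Function.update (fun i => (LinearMap.proj i : (ι → V) →ₗ[K] V)) k
    (A' ∘ₗ (c' • (LinearMap.proj k - offDiag A c k))))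

omit [Fintype ι] [LinearOrder ι] in
/-- Auxiliary evaluation of a `LinearMap.pi` of an updated family of projections. [folklore] -/
theorem pi_update_proj_apply [DecidableEq ι] (k : ι) (f : (ι → V) →ₗ[K] V) (v : ι → V) :
    LinearMap.pi (Function.update (fun i => (LinearMap.proj i : (ι → V) →ₗ[K] V)) k f) v =
      Function.update v k (f v) := by
  ext i
  rw [LinearMap.pi_apply]
  rcases eq_or_ne i k with rfl | h
  · simp
  · simp [Function.update_of_ne h]

/-- Unfolding of `offDiag`. [folklore] -/
theorem offDiag_apply (A : ι → Module.End K V) (c : K) (k : ι) (v : ι → V) :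
    offDiag A c k v = ∑ j ∈ Finset.univ.erase k, coeff A c k j (v j) := by
  simp [offDiag, LinearMap.sum_apply]

/-- The off-diagonal part of the `k`-th row does not see the `k`-th coordinate. [folklore] -/
theorem offDiag_update (A : ι → Module.End K V) (c : K) (k : ι) (v : ι → V) (w : V) :
    offDiag A c k (Function.update v k w) = offDiag A c k v := by
  rw [offDiag_apply, offDiag_apply]
  refine Finset.sum_congr rfl fun j hj => ?_
  rw [Function.update_of_ne (Finset.ne_of_mem_erase hj)]

/-- **The formula for `B_k`** ([DettweilerReiter2007, §2.1]): `(B_k v)_i = v_i` for `i ≠ k` and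
`(B_k v)_k = λ A_k v_k + Σ_{j<k} λ(A_j - 1)v_j + Σ_{j>k}(A_j - 1)v_j`.
[cite: DettweilerReiter2007, §2.1 Definition 2.1] -/
theorem convolutionEnd_apply (A : ι → Module.End K V) (c : K) (k : ι) (v : ι → V) :
    convolutionEnd A c k v = Function.update v k (c • A k (v k) + offDiag A c k v) := by
  rw [convolutionEnd, pi_update_proj_apply]
  rfl

/-- The formula for the candidate inverse of `B_k`. [folklore] -/
theorem convolutionInv_apply (A : ι → Module.End K V) (c c' : K) (A' : Module.End K V) (k : ι)
    (v : ι → V) :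
    convolutionInv A c c' A' k v = Function.update v k (A' (c' • (v k - offDiag A c k v))) := by
  rw [convolutionInv, pi_update_proj_apply]
  rfl

/-- `B_k ∘ B_k⁻¹ = 1` when `A_k A' = 1` and `λ c' = 1`. [folklore] -/
theorem convolutionEnd_convolutionInv (A : ι → Module.End K V) {c c' : K} {A' : Module.End K V}
    {k : ι} (hA : A k ∘ₗ A' = 1) (hc : c * c' = 1) (v : ι → V) :
    convolutionEnd A c k (convolutionInv A c c' A' k v) = v := by
  rw [convolutionInv_apply, convolutionEnd_apply, offDiag_update, Function.update_self,
    Function.update_idem]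
  have h1 : A k (A' (c' • (v k - offDiag A c k v))) = c' • (v k - offDiag A c k v) := by
    simpa using LinearMap.congr_fun hA (c' • (v k - offDiag A c k v))
  rw [h1, smul_smul, hc, one_smul, sub_add_cancel, Function.update_eq_self]

/-- `B_k⁻¹ ∘ B_k = 1` when `A' A_k = 1` and `c' λ = 1`. [folklore] -/
theorem convolutionInv_convolutionEnd (A : ι → Module.End K V) {c c' : K} {A' : Module.End K V}
    {k : ι} (hA : A' ∘ₗ A k = 1) (hc : c' * c = 1) (v : ι → V) :
    convolutionInv A c c' A' k (convolutionEnd A c k v) = v := by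
  rw [convolutionEnd_apply, convolutionInv_apply, offDiag_update, Function.update_self,
    Function.update_idem, add_sub_cancel_right, smul_smul, hc, one_smul]
  have h1 : A' (A k (v k)) = v k := by simpa using LinearMap.congr_fun hA (v k)
  rw [h1, Function.update_eq_self]

end Tuple

section Rep

variable {K : Type*} [CommRing K] {V : Type*} [AddCommGroup V] [Module K V]
variable {ι : Type*} [Fintype ι] [LinearOrder ι]
variable (ρ : Representation K (FreeGroup ι) V) (l : Kˣ)

/-- The **monodromy tuple** `A = (ρ(f_i))_i ∈ GL(V)^ι` of a module over the free group `F_ι` on the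
generators `f_i` ([DettweilerReiter2007, §2.1]: "an element of `Mod(K[F_r])` is viewed as a pair
`(A, V)`"). [cite: DettweilerReiter2007, §2.1] -/
abbrev tuple (ρ : Representation K (FreeGroup ι) V) : ι → Module.End K V := fun i => ρ (FreeGroup.of i)

/-- `B_k` as a unit of `End(V^ι)`, with inverse `convolutionInv` built from `A_k⁻¹ = ρ(f_k⁻¹)` and
`λ⁻¹`. [cite: DettweilerReiter2007, §2.1 Definition 2.1] -/
def convolutionUnit (k : ι) : (Module.End K (ι → V))ˣ where
  val := convolutionEnd (tuple ρ) (l : K) k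
  inv := convolutionInv (tuple ρ) (l : K) ((l⁻¹ : Kˣ) : K) (ρ (FreeGroup.of k)⁻¹) k
  val_inv := by
    refine LinearMap.ext fun v => ?_
    have hA : tuple ρ k ∘ₗ ρ (FreeGroup.of k)⁻¹ = 1 := by
      rw [← Module.End.mul_eq_comp, tuple, ← map_mul, mul_inv_cancel, map_one]
    simpa using convolutionEnd_convolutionInv (tuple ρ) hA (Units.mul_inv l) v
  inv_val := by
    refine LinearMap.ext fun v => ?_
    have hA : ρ (FreeGroup.of k)⁻¹ ∘ₗ tuple ρ k = 1 := by
      rw [← Module.End.mul_eq_comp, tuple, ← map_mul, inv_mul_cancel, map_one]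
    simpa using convolutionInv_convolutionEnd (tuple ρ) hA (Units.inv_mul l) v

/-- The **convolution** `C_λ(ρ)` of an `F_ι`-module `ρ` with `λ ∈ Kˣ`: the free group acts on
`V^ι = ι → V` by `f_k ↦ B_k`. [cite: DettweilerReiter2007, §2.1 Definition 2.1 i] -/
def convolution : Representation K (FreeGroup ι) (ι → V) :=
  (Units.coeHom (Module.End K (ι → V))).comp (FreeGroup.lift (convolutionUnit ρ l))

/-- `C_λ(ρ)(f_k) = B_k`. [cite: DettweilerReiter2007, §2.1 Definition 2.1 i] -/
@[simp]
theorem convolution_of (k : ι) :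
    convolution ρ l (FreeGroup.of k) = convolutionEnd (tuple ρ) (l : K) k := by
  simp [convolution, convolutionUnit]

/-- `C_λ(ρ)(f_k⁻¹) = B_k⁻¹`, explicitly. [folklore] -/
theorem convolution_of_inv (k : ι) :
    convolution ρ l (FreeGroup.of k)⁻¹ =
      convolutionInv (tuple ρ) (l : K) ((l⁻¹ : Kˣ) : K) (ρ (FreeGroup.of k)⁻¹) k := by
  simp [convolution, convolutionUnit]

/-- The subspace `𝒦 = ⊕_k 𝒦_k` of `V^ι`, `𝒦_k = ker(A_k - 1)` placed in the `k`-th coordinate.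
[cite: DettweilerReiter2007, §2.1] -/
def fixedVectors : Submodule K (ι → V) :=
  Submodule.pi Set.univ fun i => LinearMap.ker (tuple ρ i - 1)

omit [Fintype ι] [LinearOrder ι] in
/-- Membership in `𝒦 = ⊕ ker(A_k - 1)`. [cite: DettweilerReiter2007, §2.1] -/
theorem mem_fixedVectors_iff (v : ι → V) :
    v ∈ fixedVectors ρ ↔ ∀ i, ρ (FreeGroup.of i) (v i) = v i := by
  simp [fixedVectors, Submodule.mem_pi, LinearMap.mem_ker, sub_eq_zero]

/-- The subspace `𝒦 + ℒ` of `V^ι`, where `ℒ = ⋂_k ker(B_k - 1)` is the space of invariants of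
`C_λ(ρ)`. [cite: DettweilerReiter2007, §2.1] -/
def kerSum : Submodule K (ι → V) :=
  fixedVectors ρ ⊔ (convolution ρ l).invariants

/-- `ℒ = ⋂_k ker(B_k - 1)`: a vector is invariant under `C_λ(ρ)` iff it is fixed by every `B_k`.
[cite: DettweilerReiter2007, §2.1] -/
theorem mem_invariants_convolution_iff (v : ι → V) :
    v ∈ (convolution ρ l).invariants ↔ ∀ k, convolutionEnd (tuple ρ) (l : K) k v = v := by
  rw [Representation.mem_invariants]
  refine ⟨fun h k => by simpa using h (FreeGroup.of k), fun h g => ?_⟩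
  induction g using FreeGroup.induction_on with
  | C1 => simp
  | of k => simpa using h k
  | inv_of k _ =>
    conv_lhs => rw [← h k]
    rw [← convolution_of, ← Module.End.mul_apply, ← map_mul, inv_mul_cancel, map_one,
      Module.End.one_apply]
  | mul x y hx hy => rw [map_mul, Module.End.mul_apply, hy, hx]

variable {ρ} in
/-- On `𝒦` the off-diagonal blocks `A_j - 1` vanish. [folklore] -/
theorem offDiag_eq_zero_of_mem_fixedVectors {v : ι → V} (hv : v ∈ fixedVectors ρ) (c : K)
    (k : ι) : offDiag (tuple ρ) c k v = 0 := by
  rw [offDiag_apply]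
  refine Finset.sum_eq_zero fun j _ => ?_
  have hj : (tuple ρ j - 1) (v j) = 0 := by
    simp [(mem_fixedVectors_iff ρ v).1 hv j]
  unfold coeff
  split_ifs <;> simp [hj]

variable {ρ} in
/-- On `𝒦` the operator `B_k` multiplies the `k`-th coordinate by `λ`.
[cite: DettweilerReiter2007, §2.1] -/
theorem convolutionEnd_apply_of_mem_fixedVectors {v : ι → V} (hv : v ∈ fixedVectors ρ) (c : K)
    (k : ι) : convolutionEnd (tuple ρ) c k v = Function.update v k (c • v k) := by
  rw [convolutionEnd_apply, offDiag_eq_zero_of_mem_fixedVectors hv, add_zero]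
  have hk : (tuple ρ k) (v k) = v k := (mem_fixedVectors_iff ρ v).1 hv k
  rw [hk]

omit [Fintype ι] in
variable {ρ} in
/-- `𝒦` is stable under rescaling one coordinate. [folklore] -/
theorem update_smul_mem_fixedVectors {v : ι → V} (hv : v ∈ fixedVectors ρ) (c : K) (k : ι) :
    Function.update v k (c • v k) ∈ fixedVectors ρ := by
  rw [mem_fixedVectors_iff] at hv ⊢
  intro i
  rcases eq_or_ne i k with rfl | h
  · simp [hv i]
  · simp [Function.update_of_ne h, hv i]

/-- `𝒦` is stable under `C_λ(ρ)`. [cite: DettweilerReiter2007, §2.1] -/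
theorem fixedVectors_le_comap (g : FreeGroup ι) :
    fixedVectors ρ ≤ (fixedVectors ρ).comap (convolution ρ l g) := by
  induction g using FreeGroup.induction_on with
  | C1 => intro v hv; simpa using hv
  | of k =>
    intro v hv
    rw [Submodule.mem_comap, convolution_of, convolutionEnd_apply_of_mem_fixedVectors hv]
    exact update_smul_mem_fixedVectors hv _ _
  | inv_of k _ =>
    intro v hv
    rw [Submodule.mem_comap]
    set w : ι → V := Function.update v k (((l⁻¹ : Kˣ) : K) • v k) with hw
    have hwmem : w ∈ fixedVectors ρ := update_smul_mem_fixedVectors hv _ _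
    have hBw : convolution ρ l (FreeGroup.of k) w = v := by
      rw [convolution_of, convolutionEnd_apply_of_mem_fixedVectors hwmem, hw, Function.update_idem,
        Function.update_self, smul_smul, Units.mul_inv, one_smul, Function.update_eq_self]
    rw [← hBw, ← Module.End.mul_apply, ← map_mul, inv_mul_cancel, map_one, Module.End.one_apply]
    exact hwmem
  | mul x y hx hy =>
    intro v hv
    rw [Submodule.mem_comap, map_mul, Module.End.mul_apply]
    exact hx (hy hv)

/-- `𝒦 + ℒ` is stable under `C_λ(ρ)`. [cite: DettweilerReiter2007, §2.1] -/
theorem kerSum_le_comap (g : FreeGroup ι) :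
    kerSum ρ l ≤ (kerSum ρ l).comap (convolution ρ l g) := by
  refine sup_le ((fixedVectors_le_comap ρ l g).trans (Submodule.comap_mono le_sup_left)) ?_
  intro v hv
  rw [Submodule.mem_comap, ((convolution ρ l).mem_invariants v).1 hv g]
  exact Submodule.mem_sup_right hv

/-- `𝒦 ∩ ℒ = 0` as soon as `λ - 1` is invertible (over a field: `λ ≠ 1`), so that
`𝒦 + ℒ = 𝒦 ⊕ ℒ`. [cite: DettweilerReiter2007, §2.1] -/
theorem fixedVectors_inf_invariants_eq_bot (hl : IsUnit ((l : K) - 1)) :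
    fixedVectors ρ ⊓ (convolution ρ l).invariants = ⊥ := by
  rw [eq_bot_iff]
  rintro v ⟨hK, hL⟩
  rw [Submodule.mem_bot]
  funext k
  have hk := (mem_invariants_convolution_iff ρ l v).1 hL k
  rw [convolutionEnd_apply_of_mem_fixedVectors hK] at hk
  have hk' : ((l : K) - 1) • v k = 0 := by
    have := congr_fun hk k
    rw [Function.update_self] at this
    rw [sub_smul, one_smul, this, sub_self]
  obtain ⟨u, hu⟩ := hl
  have : v k = (↑u⁻¹ : K) • (((l : K) - 1) • v k) := by
    rw [smul_smul, ← hu, Units.inv_mul, one_smul]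
  rw [this, hk', smul_zero]
  rfl

/-- The underlying module `V^ι ⧸ (𝒦 + ℒ)` of the middle convolution `MC_λ(ρ)`.
[cite: DettweilerReiter2007, §2.1 Definition 2.1 ii] -/
abbrev Space : Type _ := (ι → V) ⧸ kerSum ρ l

end Rep

end MiddleConvolution

section Main

variable {K : Type*} [CommRing K] {V : Type*} [AddCommGroup V] [Module K V]
variable {ι : Type*} [Fintype ι] [LinearOrder ι]

open MiddleConvolution

/-- The **middle convolution** `MC_λ(ρ)` of a module `ρ` over the free group `F_ι` with a unit `λ`
(Dettweiler–Reiter's algebraic model of Katz's `MC_χ`): the representation induced by the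
convolution `C_λ(ρ)` (`f_k ↦ B_k`) on `V^ι ⧸ (𝒦 + ℒ)`, `𝒦 = ⊕ ker(A_k - 1)`,
`ℒ = ⋂ ker(B_k - 1)`.  For `K = ℂ`, `ι = {1,…,r}` and `ρ` the monodromy of a local system `𝓥` on
`ℂ ∖ {t₁,…,t_r}` in the standard homotopy basis, this is the monodromy of Katz's `MC_χ(𝓥)` with
`χ ↦ λ` ([DettweilerReiter2007, Thm. 1.1]; [Katz1996, §5.1]).
[cite: DettweilerReiter2007, §2.1 Definition 2.1 ii] -/
def middleConvolution (ρ : Representation K (FreeGroup ι) V) (l : Kˣ) :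
    Representation K (FreeGroup ι) (Space ρ l) :=
  (convolution ρ l).quotient (kerSum ρ l) (kerSum_le_comap ρ l)

/-- `MC_λ(ρ)(g) [v] = [C_λ(ρ)(g) v]`. [cite: DettweilerReiter2007, §2.1 Definition 2.1 ii] -/
@[simp]
theorem middleConvolution_mk (ρ : Representation K (FreeGroup ι) V) (l : Kˣ) (g : FreeGroup ι)
    (v : ι → V) :
    middleConvolution ρ l g (Submodule.Quotient.mk v) =
      Submodule.Quotient.mk (convolution ρ l g v) :=
  rfl

/-- The generator `f_k` acts on `MC_λ(ρ)` by the class of `B_k`.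
[cite: DettweilerReiter2007, §2.1 Definition 2.1 ii] -/
theorem middleConvolution_of_mk (ρ : Representation K (FreeGroup ι) V) (l : Kˣ) (k : ι)
    (v : ι → V) :
    middleConvolution ρ l (FreeGroup.of k) (Submodule.Quotient.mk v) =
      Submodule.Quotient.mk (convolutionEnd (tuple ρ) (l : K) k v) := by
  simp

/-- The quotient map `V^ι → MC_λ(ρ)` intertwines `C_λ(ρ)` and `MC_λ(ρ)`. [folklore] -/
def MiddleConvolution.mkQ (ρ : Representation K (FreeGroup ι) V) (l : Kˣ) :
    (convolution ρ l).IntertwiningMap (middleConvolution ρ l) :=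
  LinearMap.intertwiningMap_of_isIntertwiningMap (convolution ρ l) (middleConvolution ρ l)
    (kerSum ρ l).mkQ fun _ _ => rfl

/-- The quotient map onto `MC_λ(ρ)` is surjective. [folklore] -/
theorem MiddleConvolution.mkQ_surjective (ρ : Representation K (FreeGroup ι) V) (l : Kˣ) :
    Function.Surjective (MiddleConvolution.mkQ ρ l) :=
  Submodule.mkQ_surjective _

end Main

namespace LocalSystem

variable {K : Type u} [CommRing K] {S : Type u} [TopologicalSpace S] (V : LocalSystem K S)
variable {ι : Type*} [Fintype ι] [LinearOrder ι]

/-- The monodromy of a local system `𝓥` at `s` pulled back to the free group on an ordered family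
of loops `γ : ι → π₁(S, s)` — the **monodromy tuple** `(ρ_𝓥(γ_i))_i` of [Dettweiler2008MC, Def. 1.1]
(there `S = 𝔸¹ ∖ {u₁,…,u_r}` and `γ` are simple loops around the punctures, free generators of `π₁`).
[cite: Dettweiler2008MC, Definition 1.1] -/
def monodromyTupleRep (s : S) (γ : ι → FundamentalGroup S s) :
    Representation K (FreeGroup ι) (V.fiber s) :=
  (V.monodromyRep s).comp (FreeGroup.lift γ)

omit [Fintype ι] [LinearOrder ι] in
/-- The monodromy tuple representation on a generator is the monodromy along the chosen loop.
[cite: Dettweiler2008MC, Definition 1.1] -/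
@[simp]
theorem monodromyTupleRep_of (s : S) (γ : ι → FundamentalGroup S s) (i : ι) :
    V.monodromyTupleRep s γ (FreeGroup.of i) = V.monodromyRep s (γ i) := by
  simp [monodromyTupleRep]

/-- **Katz's middle convolution of a local system, in the Dettweiler–Reiter model.**  For a local
system `𝓥` of `K`-modules on `S`, a base point `s`, an ordered family of loops `γ : ι → π₁(S, s)`
and a unit `λ` (the value of the Kummer character `χ` on the positive generator of `π₁(𝔾_m)`),
`𝓥.middleConvolution s γ λ = MC_λ(ρ_𝓥 ∘ γ)` is the middle convolution of the monodromy tuple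
`(ρ_𝓥(γ_i))_i`.  When `S = ℂ ∖ {t₁,…,t_r}` and `γ₁,…,γ_r` is the standard homotopy basis, this
`F_r = π₁(S)`-module is the monodromy representation of the local system
`MC_χ(𝓥) = R¹(p̄₂)_*(j_*(p₁^*𝓥 ⊗ q^*𝓛_χ))`, whose stalk is the parabolic cohomology
`H¹(ℙ¹, j_*(𝓥 ⊗ 𝓛_χ(y - x)))` ([DettweilerReiter2007, Thm. 1.1]; [Dettweiler2008MC, Prop. 1.5,
Thm. 1.10]; [Katz1996, §5.1]). [cite: DettweilerReiter2007, Theorem 1.1 and Definition 2.1] -/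
def middleConvolution (s : S) (γ : ι → FundamentalGroup S s) (l : Kˣ) :
    Representation K (FreeGroup ι) (MiddleConvolution.Space (V.monodromyTupleRep s γ) l) :=
  Motives.middleConvolution (V.monodromyTupleRep s γ) l

/-- Unfolding of `LocalSystem.middleConvolution`. [cite: DettweilerReiter2007, Definition 2.1] -/
theorem middleConvolution_def (s : S) (γ : ι → FundamentalGroup S s) (l : Kˣ) :
    V.middleConvolution s γ l = Motives.middleConvolution (V.monodromyTupleRep s γ) l :=
  rfl

end LocalSystem


/-! ### Functoriality ([DettweilerReiter2007, Prop. 2.2]) -/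

namespace MiddleConvolution

section Map

variable {K : Type*} [CommRing K] {V : Type*} [AddCommGroup V] [Module K V]
variable {V' : Type*} [AddCommGroup V'] [Module K V']
variable {ι : Type*} [Fintype ι] [LinearOrder ι]
variable {ρ : Representation K (FreeGroup ι) V} {ρ' : Representation K (FreeGroup ι) V'}

omit [Fintype ι] [LinearOrder ι] in
/-- A linear map applied coordinatewise: `φ^ι : V^ι → V'^ι`. [folklore] -/
def piMap (φ : V →ₗ[K] V') : (ι → V) →ₗ[K] (ι → V') :=
  LinearMap.pi fun i => φ ∘ₗ LinearMap.proj i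

omit [Fintype ι] [LinearOrder ι] in
/-- `φ^ι` acts coordinatewise. [folklore] -/
@[simp]
theorem piMap_apply (φ : V →ₗ[K] V') (v : ι → V) (i : ι) : piMap φ v i = φ (v i) := rfl

omit [Fintype ι] [LinearOrder ι] in
/-- The intertwining identity on the generators, in `toLinearMap` form. [folklore] -/
theorem toLinearMap_tuple_apply (φ : ρ.IntertwiningMap ρ') (j : ι) (x : V) :
    φ.toLinearMap (tuple ρ j x) = tuple ρ' j (φ.toLinearMap x) :=
  φ.isIntertwining ρ ρ' (FreeGroup.of j) x

/-- A morphism of `F_ι`-modules, applied coordinatewise, intertwines `B_k` and `B'_k`.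
[cite: DettweilerReiter2007, §2.2] -/
theorem piMap_convolutionEnd (φ : ρ.IntertwiningMap ρ') (c : K) (k : ι) (v : ι → V) :
    piMap φ.toLinearMap (convolutionEnd (tuple ρ) c k v) =
      convolutionEnd (tuple ρ') c k (piMap φ.toLinearMap v) := by
  ext i
  rw [piMap_apply, convolutionEnd_apply, convolutionEnd_apply]
  rcases eq_or_ne i k with rfl | hik
  · rw [Function.update_self, Function.update_self]
    simp only [map_add, map_smul, offDiag_apply, map_sum, piMap_apply, toLinearMap_tuple_apply]
    congr 1
    refine Finset.sum_congr rfl fun j _ => ?_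
    unfold coeff
    split_ifs
    · simp only [LinearMap.smul_apply, map_smul, LinearMap.sub_apply, map_sub,
        toLinearMap_tuple_apply, Module.End.one_apply]
    · simp only [LinearMap.sub_apply, map_sub, toLinearMap_tuple_apply, Module.End.one_apply]
  · rw [Function.update_of_ne hik, Function.update_of_ne hik, piMap_apply]

/-- A morphism of `F_ι`-modules, applied coordinatewise, intertwines `C_λ(ρ)` and `C_λ(ρ')`.
[cite: DettweilerReiter2007, §2.2] -/
theorem piMap_convolution (φ : ρ.IntertwiningMap ρ') (l : Kˣ) (g : FreeGroup ι) (v : ι → V) :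
    piMap φ.toLinearMap (convolution ρ l g v) = convolution ρ' l g (piMap φ.toLinearMap v) := by
  induction g using FreeGroup.induction_on generalizing v with
  | C1 => simp
  | of k => rw [convolution_of, convolution_of, piMap_convolutionEnd]
  | inv_of k ih =>
    -- apply the `of` case to `w = C(f_k)⁻¹ v` and cancel
    have h1 : convolution ρ l (FreeGroup.of k) (convolution ρ l (FreeGroup.of k)⁻¹ v) = v := by
      rw [← Module.End.mul_apply, ← map_mul, mul_inv_cancel, map_one, Module.End.one_apply]
    have h2 := ih (convolution ρ l (FreeGroup.of k)⁻¹ v)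
    rw [h1] at h2
    rw [h2, ← Module.End.mul_apply, ← map_mul, inv_mul_cancel, map_one, Module.End.one_apply]
  | mul x y hx hy => rw [map_mul, Module.End.mul_apply, map_mul, Module.End.mul_apply, hx, hy]

/-- `C_λ` on morphisms: `φ ↦ φ^ι`. [cite: DettweilerReiter2007, Proposition 2.2] -/
def convolutionMap (φ : ρ.IntertwiningMap ρ') (l : Kˣ) :
    (convolution ρ l).IntertwiningMap (convolution ρ' l) :=
  LinearMap.intertwiningMap_of_isIntertwiningMap (convolution ρ l) (convolution ρ' l)
    (piMap φ.toLinearMap) fun g v => piMap_convolution φ l g v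

/-- `C_λ(φ)` acts coordinatewise by `φ`. [cite: DettweilerReiter2007, §2.2] -/
@[simp]
theorem convolutionMap_apply (φ : ρ.IntertwiningMap ρ') (l : Kˣ) (v : ι → V) (i : ι) :
    convolutionMap φ l v i = φ (v i) := rfl

/-- `φ^ι` maps `𝒦 + ℒ` into `𝒦' + ℒ'`. [cite: DettweilerReiter2007, §2.2] -/
theorem kerSum_le_comap_piMap (φ : ρ.IntertwiningMap ρ') (l : Kˣ) :
    kerSum ρ l ≤ (kerSum ρ' l).comap (piMap φ.toLinearMap) := by
  refine sup_le ?_ ?_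
  · intro v hv
    rw [Submodule.mem_comap]
    refine Submodule.mem_sup_left ?_
    rw [mem_fixedVectors_iff] at hv ⊢
    intro i
    rw [piMap_apply, ← toLinearMap_tuple_apply]
    change φ.toLinearMap (ρ (FreeGroup.of i) (v i)) = _
    rw [hv i]
  · intro v hv
    rw [Submodule.mem_comap]
    refine Submodule.mem_sup_right ?_
    rw [Representation.mem_invariants] at hv ⊢
    intro g
    rw [← piMap_convolution, hv g]

/-- **`MC_λ` on morphisms** ([DettweilerReiter2007, §2.2]: a morphism `V → V'` of `F_r`-modules
induces `C_λ(V) → C_λ(V')` mapping `𝒦, ℒ` to `𝒦', ℒ'`, hence `MC_λ(V) → MC_λ(V')`; with these maps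
`MC_λ` is a covariant end-exact functor, Prop. 2.2). [cite: DettweilerReiter2007, Proposition 2.2] -/
def map (φ : ρ.IntertwiningMap ρ') (l : Kˣ) :
    (middleConvolution ρ l).IntertwiningMap (middleConvolution ρ' l) :=
  LinearMap.intertwiningMap_of_isIntertwiningMap (middleConvolution ρ l) (middleConvolution ρ' l)
    (Submodule.mapQ (kerSum ρ l) (kerSum ρ' l) (piMap φ.toLinearMap) (kerSum_le_comap_piMap φ l))
    fun g x => by
      induction x using Submodule.Quotient.induction_on with
      | H v =>
        rw [middleConvolution_mk, Submodule.mapQ_apply, Submodule.mapQ_apply, middleConvolution_mk,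
          piMap_convolution]

/-- `MC_λ(φ)[v] = [φ^ι v]`. [cite: DettweilerReiter2007, §2.2] -/
@[simp]
theorem map_mk (φ : ρ.IntertwiningMap ρ') (l : Kˣ) (v : ι → V) :
    map φ l (Submodule.Quotient.mk v) = Submodule.Quotient.mk (piMap φ.toLinearMap v) := rfl

/-- `MC_λ(id) = id`. [cite: DettweilerReiter2007, Proposition 2.2] -/
theorem map_id (l : Kˣ) (x : Space ρ l) :
    map (Representation.IntertwiningMap.id ρ) l x = x := by
  induction x using Submodule.Quotient.induction_on with
  | H v => rfl

/-- `MC_λ(ψ ∘ φ) = MC_λ(ψ) ∘ MC_λ(φ)`. [cite: DettweilerReiter2007, Proposition 2.2] -/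
theorem map_comp {V'' : Type*} [AddCommGroup V''] [Module K V'']
    {ρ'' : Representation K (FreeGroup ι) V''} (ψ : ρ'.IntertwiningMap ρ'')
    (φ : ρ.IntertwiningMap ρ') (l : Kˣ) (x : Space ρ l) :
    map (ψ.comp φ) l x = map ψ l (map φ l x) := by
  induction x using Submodule.Quotient.induction_on with
  | H v => rfl

/-- `MC_λ` is additive on morphisms. [cite: DettweilerReiter2007, Proposition 2.2] -/
theorem map_add (φ ψ : ρ.IntertwiningMap ρ') (l : Kˣ) (x : Space ρ l) :
    map (φ + ψ) l x = map φ l x + map ψ l x := by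
  induction x using Submodule.Quotient.induction_on with
  | H v => rfl

end Map

end MiddleConvolution

/-! ### The rank formula ([DettweilerReiter2007, Thm. 2.4 (i)]) -/

namespace MiddleConvolution

section Defect

variable {K : Type*} [CommRing K] {V : Type*} [AddCommGroup V] [Module K V]
variable {ι : Type*} [Fintype ι] [LinearOrder ι]

/-- The summands of the `k`-th **defect** `(B_k w)_k - w_k = Σ_j dTerm k j`:
`λ(A_j w_j - w_j)` (`j < k`), `λ A_k w_k - w_k` (`j = k`), `A_j w_j - w_j` (`j > k`). [folklore] -/
def dTerm (A : ι → Module.End K V) (c : K) (w : ι → V) (k j : ι) : V :=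
  if j < k then c • (A j (w j) - w j) else if j = k then c • A k (w k) - w k else A j (w j) - w j

/-- The `k`-th defect `(B_k w)_k - w_k` of a vector `w ∈ V^ι`; `w ∈ ℒ` iff all defects vanish.
[folklore] -/
def defect (A : ι → Module.End K V) (c : K) (w : ι → V) (k : ι) : V :=
  convolutionEnd A c k w k - w k

/-- The `k`-th defect is the sum of the `dTerm`s. [folklore] -/
theorem defect_eq_sum (A : ι → Module.End K V) (c : K) (w : ι → V) (k : ι) :
    defect A c w k = ∑ j, dTerm A c w k j := by
  rw [defect, convolutionEnd_apply, Function.update_self, offDiag_apply,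
    ← Finset.add_sum_erase _ _ (Finset.mem_univ k)]
  have h1 : dTerm A c w k k = c • A k (w k) - w k := by simp [dTerm]
  have h2 : ∀ j ∈ Finset.univ.erase k, dTerm A c w k j = coeff A c k j (w j) := by
    intro j hj
    have hjk : j ≠ k := Finset.ne_of_mem_erase hj
    unfold dTerm coeff
    rw [if_neg hjk]
    split_ifs with h
    · simp [smul_sub]
    · simp
  rw [h1, Finset.sum_congr rfl h2]
  abel

/-- `w ∈ ⋂ ker(B_k - 1)` iff all defects vanish. [folklore] -/
theorem convolutionEnd_eq_self_iff (A : ι → Module.End K V) (c : K) (w : ι → V) (k : ι) :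
    convolutionEnd A c k w = w ↔ defect A c w k = 0 := by
  rw [defect, sub_eq_zero]
  refine ⟨fun h => by rw [h], fun h => funext fun i => ?_⟩
  rcases eq_or_ne i k with rfl | hi
  · exact h
  · rw [convolutionEnd_apply, Function.update_of_ne hi]

end Defect

section FinDefect

variable {K : Type*} [CommRing K] {V : Type*} [AddCommGroup V] [Module K V] {m : ℕ}

/-- The successor inside `Fin (m+1)` of an index `k < m`. [folklore] -/
abbrev nxt (k : Fin (m + 1)) (hk : (k : ℕ) < m) : Fin (m + 1) := ⟨k + 1, by omega⟩

/-- **Difference of consecutive defects**: `D_k - D_{k+1} = (λ - 1)(w_k - A_{k+1} w_{k+1})`.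
[cite: DettweilerReiter2007, §2.1] -/
theorem defect_sub_defect_nxt (A : Fin (m + 1) → Module.End K V) (c : K) (w : Fin (m + 1) → V)
    (k : Fin (m + 1)) (hk : (k : ℕ) < m) :
    defect A c w k - defect A c w (nxt k hk) = (c - 1) • (w k - A (nxt k hk) (w (nxt k hk))) := by
  rw [defect_eq_sum, defect_eq_sum, ← Finset.sum_sub_distrib]
  have key : ∀ j : Fin (m + 1), dTerm A c w k j - dTerm A c w (nxt k hk) j =
      (if j = k then (c - 1) • w k else 0) +
        (if j = nxt k hk then (1 - c) • A (nxt k hk) (w (nxt k hk)) else 0) := by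
    intro j
    unfold dTerm
    by_cases h1 : j = k
    · subst h1
      have hne : j ≠ nxt j hk := fun h => by simp [Fin.ext_iff] at h
      have hlt : j < nxt j hk := by simp [Fin.lt_def]
      simp only [lt_self_iff_false, if_false, if_true, hlt, hne, add_zero]
      rw [smul_sub, sub_smul, one_smul]
      abel
    · by_cases h2 : j = nxt k hk
      · subst h2
        have hnlt : ¬ (nxt k hk < k) := by simp [Fin.lt_def]
        have hnlt' : ¬ (nxt k hk < nxt k hk) := lt_irrefl _
        simp only [hnlt, if_false, h1, hnlt', if_true, zero_add]
        rw [sub_smul, one_smul]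
        abel
      · have hiff : (j < k) ↔ (j < nxt k hk) := by
          have h1' : (j : ℕ) ≠ k := fun h => h1 (Fin.ext h)
          have h2' : (j : ℕ) ≠ k + 1 := fun h => h2 (Fin.ext h)
          rw [Fin.lt_def, Fin.lt_def]
          show (j : ℕ) < k ↔ (j : ℕ) < k + 1
          omega
        by_cases h3 : j < k
        · have h4 : j < nxt k hk := hiff.1 h3
          simp [h3, h4, h1, h2]
        · have h4 : ¬ j < nxt k hk := fun h => h3 (hiff.2 h)
          simp [h3, h4, h1, h2]
  rw [Finset.sum_congr rfl fun j _ => key j, Finset.sum_add_distrib, Finset.sum_ite_eq',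
    Finset.sum_ite_eq']
  simp only [Finset.mem_univ, if_true, smul_sub, sub_smul, one_smul]
  abel

/-- If the recursion `w_k = A_{k+1} w_{k+1}` (`k < m`) holds, all defects are equal to the last one.
[folklore] -/
theorem defect_eq_defect_last_of_rec (A : Fin (m + 1) → Module.End K V) (c : K)
    (w : Fin (m + 1) → V) (hrec : ∀ (k : Fin (m + 1)) (hk : (k : ℕ) < m), w k = A (nxt k hk) (w (nxt k hk)))
    (k : Fin (m + 1)) : defect A c w k = defect A c w (Fin.last m) := by
  suffices h : ∀ (d : ℕ) (k : Fin (m + 1)), (k : ℕ) + d = m → defect A c w k = defect A c w (Fin.last m) by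
    exact h (m - k) k (by omega)
  intro d
  induction d with
  | zero =>
    intro k hk
    have : k = Fin.last m := Fin.ext (by simpa using hk)
    rw [this]
  | succ d ih =>
    intro k hk
    have hkm : (k : ℕ) < m := by omega
    have h1 := defect_sub_defect_nxt A c w k hkm
    rw [hrec k hkm, sub_self, smul_zero, sub_eq_zero] at h1
    rw [h1]
    exact ih _ (by show (k : ℕ) + 1 + d = m; omega)

/-- If all defects vanish and `λ - 1` is a unit, the recursion `w_k = A_{k+1} w_{k+1}` holds.
[cite: DettweilerReiter2007, §2.1] -/
theorem rec_of_defect_eq_zero (A : Fin (m + 1) → Module.End K V) {c : K} (hc : IsUnit (c - 1))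
    (w : Fin (m + 1) → V) (h : ∀ k, defect A c w k = 0) (k : Fin (m + 1)) (hk : (k : ℕ) < m) :
    w k = A (nxt k hk) (w (nxt k hk)) := by
  have h1 := defect_sub_defect_nxt A c w k hk
  rw [h k, h (nxt k hk), sub_zero] at h1
  obtain ⟨u, hu⟩ := hc
  have h2 : w k - A (nxt k hk) (w (nxt k hk)) = 0 := by
    have := congrArg (fun x => (↑u⁻¹ : K) • x) h1
    simpa [smul_smul, ← hu] using this.symm
  exact sub_eq_zero.1 h2

end FinDefect

section Suffix

/-- The ordered suffix products `f_k f_{k+1} ⋯ f_{n-1}` of the free generators of `F_n`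
(`= 1` for `k ≥ n`). [folklore] -/
def suffixProd (n k : ℕ) : FreeGroup (Fin n) :=
  ((List.ofFn (FreeGroup.of : Fin n → FreeGroup (Fin n))).drop k).prod

/-- Empty suffix products are `1`. [folklore] -/
theorem suffixProd_of_le {n k : ℕ} (h : n ≤ k) : suffixProd n k = 1 := by
  rw [suffixProd, List.drop_eq_nil_of_le (by simpa using h), List.prod_nil]

/-- `f_k ⋯ f_{n-1} = f_k · (f_{k+1} ⋯ f_{n-1})`. [folklore] -/
theorem suffixProd_eq_of_mul (n : ℕ) (k : Fin n) :
    suffixProd n k = FreeGroup.of k * suffixProd n (k + 1) := by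
  have h : (k : ℕ) < (List.ofFn (FreeGroup.of : Fin n → FreeGroup (Fin n))).length := by simp
  rw [suffixProd, List.drop_eq_getElem_cons h, List.prod_cons, List.getElem_ofFn]
  rfl

/-- `A₁ ⋯ A_r` as an element `f₁ ⋯ f_r` of the free group (ordered product of all generators).
[cite: DettweilerReiter2007, Theorem 2.4] -/
def prodGenerators (n : ℕ) : FreeGroup (Fin n) :=
  (List.ofFn (FreeGroup.of : Fin n → FreeGroup (Fin n))).prod

/-- The full suffix product is `f₁ ⋯ f_r`. [folklore] -/
theorem suffixProd_zero (n : ℕ) : suffixProd n 0 = prodGenerators n := by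
  simp [suffixProd, prodGenerators]

end Suffix

section Invariants

variable {K : Type*} [CommRing K] {V : Type*} [AddCommGroup V] [Module K V] {m : ℕ}
variable (ρ : Representation K (FreeGroup (Fin (m + 1))) V) (l : Kˣ)

/-- Closed form of the recursion: `w_k = A_{k+1} ⋯ A_m w_m`. [cite: DettweilerReiter2007, §2.1] -/
theorem eq_suffixProd_apply_last_of_rec (w : Fin (m + 1) → V)
    (hrec : ∀ (k : Fin (m + 1)) (hk : (k : ℕ) < m), w k = tuple ρ (nxt k hk) (w (nxt k hk)))
    (k : Fin (m + 1)) : w k = ρ (suffixProd (m + 1) (k + 1)) (w (Fin.last m)) := by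
  suffices h : ∀ (d : ℕ) (k : Fin (m + 1)), (k : ℕ) + d = m →
      w k = ρ (suffixProd (m + 1) (k + 1)) (w (Fin.last m)) by
    exact h (m - k) k (by omega)
  intro d
  induction d with
  | zero =>
    intro k hk
    have hk' : k = Fin.last m := Fin.ext (by simpa using hk)
    rw [hk', suffixProd_of_le (by simp), map_one, Module.End.one_apply]
  | succ d ih =>
    intro k hk
    have hkm : (k : ℕ) < m := by omega
    rw [hrec k hkm, ih (nxt k hkm) (by show (k : ℕ) + 1 + d = m; omega), ← Module.End.mul_apply,
      ← map_mul]
    congr 2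
    exact (suffixProd_eq_of_mul (m + 1) (nxt k hkm)).symm

/-- The vector `(A_{k+1} ⋯ A_m v)_k` attached to `v ∈ V`. [cite: DettweilerReiter2007, §2.1] -/
def suffixVec (v : V) : Fin (m + 1) → V := fun k => ρ (suffixProd (m + 1) (k + 1)) v

/-- The last coordinate of `suffixVec ρ v` is `v`. [folklore] -/
theorem suffixVec_last (v : V) : suffixVec ρ v (Fin.last m) = v := by
  simp [suffixVec, suffixProd_of_le]

/-- `suffixVec ρ v` satisfies the recursion `w_k = A_{k+1} w_{k+1}`. [folklore] -/
theorem suffixVec_rec (v : V) (k : Fin (m + 1)) (hk : (k : ℕ) < m) :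
    suffixVec ρ v k = tuple ρ (nxt k hk) (suffixVec ρ v (nxt k hk)) := by
  simp only [suffixVec, tuple, ← Module.End.mul_apply, ← map_mul]
  congr 2
  exact suffixProd_eq_of_mul (m + 1) (nxt k hk)

/-- The last defect of a vector satisfying the recursion: `D_m = λ A₀ A₁ ⋯ A_m w_m - w_m`.
[cite: DettweilerReiter2007, §2.1] -/
theorem defect_last_suffixVec (c : K) (v : V) :
    defect (tuple ρ) c (suffixVec ρ v) (Fin.last m) = c • ρ (prodGenerators (m + 1)) v - v := by
  rw [defect_eq_sum]
  -- write the summands as a function of the natural-number index and telescope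
  set P : ℕ → V := fun j => ρ (suffixProd (m + 1) j) v with hP
  have hterm : ∀ j : Fin (m + 1), dTerm (tuple ρ) c (suffixVec ρ v) (Fin.last m) j =
      (if (j : ℕ) < m then c • (P j - P (j + 1)) else c • P m - P (m + 1)) := by
    intro j
    have hwj : suffixVec ρ v j = P (j + 1) := rfl
    have hAj : tuple ρ j (P (j + 1)) = P j := by
      simp only [tuple, hP, ← Module.End.mul_apply, ← map_mul]
      congr 2
      exact (suffixProd_eq_of_mul (m + 1) j).symm
    unfold dTerm
    by_cases hj : (j : ℕ) < m
    · have hlt : j < Fin.last m := Fin.lt_def.2 (by simpa using hj)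
      simp only [hlt, if_true, hj, hwj, hAj]
    · have hjm : j = Fin.last m := Fin.ext (by
        have := j.is_lt
        simp only [Fin.val_last]; omega)
      subst hjm
      simp only [Fin.val_last] at hAj hwj
      simp only [lt_self_iff_false, if_false, if_true, Fin.val_last, hwj, hAj]
  rw [Finset.sum_congr rfl fun j _ => hterm j]
  rw [Fin.sum_univ_eq_sum_range (fun j => if j < m then c • (P j - P (j + 1)) else c • P m - P (m + 1))
    (m + 1), Finset.sum_range_succ]
  have hsum : ∑ j ∈ Finset.range m, (if j < m then c • (P j - P (j + 1)) else c • P m - P (m + 1)) =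
      c • (P 0 - P m) := by
    rw [← Finset.sum_range_sub', Finset.smul_sum]
    exact Finset.sum_congr rfl fun j hj => by rw [if_pos (Finset.mem_range.1 hj)]
  rw [hsum, if_neg (lt_irrefl m)]
  have hP0 : P 0 = ρ (prodGenerators (m + 1)) v := by
    show ρ (suffixProd (m + 1) 0) v = _
    rw [suffixProd_zero]
  have hPm1 : P (m + 1) = v := by
    simp only [hP]
    rw [suffixProd_of_le le_rfl, map_one, Module.End.one_apply]
  rw [hP0, hPm1, smul_sub]
  abel

/-- **Description of `ℒ`** ([DettweilerReiter2007, §2.1]): for `λ ≠ 1` (here: `λ - 1` a unit),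
`w ∈ ℒ = ⋂ ker(B_k - 1)` iff `w = (A_{k+1} ⋯ A_m v)_k` for a (unique) `v ∈ ker(λ A₀ ⋯ A_m - 1)`,
namely `v = w_m`. [cite: DettweilerReiter2007, §2.1] -/
theorem mem_invariants_convolution_iff_eq_suffixVec (hl : IsUnit ((l : K) - 1))
    (w : Fin (m + 1) → V) :
    w ∈ (convolution ρ l).invariants ↔
      w = suffixVec ρ (w (Fin.last m)) ∧
        (l : K) • ρ (prodGenerators (m + 1)) (w (Fin.last m)) = w (Fin.last m) := by
  rw [mem_invariants_convolution_iff]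
  simp only [convolutionEnd_eq_self_iff]
  constructor
  · intro h
    have hrec := rec_of_defect_eq_zero (tuple ρ) hl w h
    have hw : w = suffixVec ρ (w (Fin.last m)) :=
      funext fun k => eq_suffixProd_apply_last_of_rec ρ w hrec k
    refine ⟨hw, ?_⟩
    have hlast := h (Fin.last m)
    rw [hw, defect_last_suffixVec] at hlast
    exact sub_eq_zero.1 hlast
  · rintro ⟨hw, hv⟩ k
    rw [hw, defect_eq_defect_last_of_rec (tuple ρ) (l : K) _ (fun k hk => suffixVec_rec ρ _ k hk),
      defect_last_suffixVec, hv, sub_self]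

/-- **`ℒ ≅ ker(λ A₁⋯A_r - 1)`** via the last coordinate ([DettweilerReiter2007, §2.1]:
`ℒ = {(A₂⋯A_r v, A₃⋯A_r v, …, v) | v ∈ ker(λ·A₁⋯A_r - 1)}` for `λ ≠ 1`).
[cite: DettweilerReiter2007, §2.1] -/
def invariantsEquivKer (hl : IsUnit ((l : K) - 1)) :
    (convolution ρ l).invariants ≃ₗ[K]
      LinearMap.ker ((l : K) • ρ (prodGenerators (m + 1)) - 1) where
  toFun w := ⟨(w : Fin (m + 1) → V) (Fin.last m), by
    rw [LinearMap.mem_ker, LinearMap.sub_apply, LinearMap.smul_apply, Module.End.one_apply,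
      sub_eq_zero]
    exact ((mem_invariants_convolution_iff_eq_suffixVec ρ l hl _).1 w.2).2⟩
  map_add' _ _ := rfl
  map_smul' _ _ := rfl
  invFun v := ⟨suffixVec ρ (v : V), by
    rw [mem_invariants_convolution_iff_eq_suffixVec ρ l hl, suffixVec_last]
    refine ⟨rfl, ?_⟩
    have := v.2
    rw [LinearMap.mem_ker, LinearMap.sub_apply, LinearMap.smul_apply, Module.End.one_apply,
      sub_eq_zero] at this
    exact this⟩
  left_inv w := by
    apply Subtype.ext
    exact (((mem_invariants_convolution_iff_eq_suffixVec ρ l hl _).1 w.2).1).symm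
  right_inv v := by
    apply Subtype.ext
    exact suffixVec_last ρ (v : V)

end Invariants

section PiKer

variable {K : Type*} [CommRing K] {V : Type*} [AddCommGroup V] [Module K V] {ι : Type*}

/-- `𝒦 = Π_k ker(A_k - 1)` as a product of modules. [folklore] -/
def fixedVectorsEquivPi (ρ : Representation K (FreeGroup ι) V) :
    fixedVectors ρ ≃ₗ[K] ((i : ι) → LinearMap.ker (tuple ρ i - 1)) where
  toFun v := fun i => ⟨(v : ι → V) i, (Submodule.mem_pi.1 v.2) i trivial⟩
  map_add' _ _ := rfl
  map_smul' _ _ := rfl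
  invFun w := ⟨fun i => (w i : V), Submodule.mem_pi.2 fun i _ => (w i).2⟩
  left_inv _ := rfl
  right_inv _ := rfl

end PiKer

section Rank

variable {K : Type*} [Field K] {V : Type*} [AddCommGroup V] [Module K V] [FiniteDimensional K V]

open Module

/-- The rank formula for `r = m + 1 ≥ 1` generators. [cite: DettweilerReiter2007, Theorem 2.4 (i)] -/
theorem finrank_space_add_finrank_succ {m : ℕ} (ρ : Representation K (FreeGroup (Fin (m + 1))) V)
    (l : Kˣ) (hl : (l : K) ≠ 1) :
    finrank K (Space ρ l) + finrank K V =
      ∑ k, finrank K (LinearMap.range (tuple ρ k - 1)) +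
        finrank K (LinearMap.range ((l : K) • ρ (prodGenerators (m + 1)) - 1)) := by
  have hl' : IsUnit ((l : K) - 1) := (sub_ne_zero.2 hl).isUnit
  -- dimension bookkeeping
  have h1 := (kerSum ρ l).finrank_quotient_add_finrank
  have h2 : finrank K (kerSum ρ l) =
      finrank K (fixedVectors ρ) + finrank K (convolution ρ l).invariants := by
    have := Submodule.finrank_sup_add_finrank_inf_eq (fixedVectors ρ) (convolution ρ l).invariants
    rw [fixedVectors_inf_invariants_eq_bot ρ l hl', finrank_bot, add_zero] at this
    exact this
  have h3 : finrank K (fixedVectors ρ) = ∑ k, finrank K (LinearMap.ker (tuple ρ k - 1)) := by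
    rw [(fixedVectorsEquivPi ρ).finrank_eq, finrank_pi_fintype]
  have h4 : finrank K (convolution ρ l).invariants =
      finrank K (LinearMap.ker ((l : K) • ρ (prodGenerators (m + 1)) - 1)) :=
    (invariantsEquivKer ρ l hl').finrank_eq
  have h5 : finrank K (Fin (m + 1) → V) = ∑ _k : Fin (m + 1), finrank K V := by
    rw [finrank_pi_fintype]
  have h6 : ∀ k : Fin (m + 1), finrank K (LinearMap.range (tuple ρ k - 1)) +
      finrank K (LinearMap.ker (tuple ρ k - 1)) = finrank K V :=
    fun k => LinearMap.finrank_range_add_finrank_ker _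
  have h7 := LinearMap.finrank_range_add_finrank_ker ((l : K) • ρ (prodGenerators (m + 1)) - 1)
  have h8 : ∑ k : Fin (m + 1), finrank K V =
      ∑ k, finrank K (LinearMap.range (tuple ρ k - 1)) +
        ∑ k, finrank K (LinearMap.ker (tuple ρ k - 1)) := by
    rw [← Finset.sum_add_distrib]
    exact Finset.sum_congr rfl fun k _ => (h6 k).symm
  unfold Space
  omega

omit [FiniteDimensional K V] in
/-- The rank formula for `r = 0` generators (then `MC_λ(V) = 0` and `λ·1 - 1` is invertible).
[cite: DettweilerReiter2007, Theorem 2.4 (i)] -/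
theorem finrank_space_add_finrank_zero (ρ : Representation K (FreeGroup (Fin 0)) V) (l : Kˣ)
    (hl : (l : K) ≠ 1) :
    finrank K (Space ρ l) + finrank K V =
      ∑ k, finrank K (LinearMap.range (tuple ρ k - 1)) +
        finrank K (LinearMap.range ((l : K) • ρ (prodGenerators 0) - 1)) := by
  have h0 : finrank K (Space ρ l) = 0 := by
    apply finrank_zero_of_subsingleton
  have hprod : prodGenerators 0 = 1 := by simp [prodGenerators]
  have hrange : LinearMap.range ((l : K) • ρ (prodGenerators 0) - 1) = ⊤ := by
    rw [hprod, map_one, LinearMap.range_eq_top]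
    intro v
    refine ⟨((l : K) - 1)⁻¹ • v, ?_⟩
    simp only [LinearMap.sub_apply, LinearMap.smul_apply, Module.End.one_apply]
    rw [smul_smul, ← sub_smul, ← sub_one_mul, mul_inv_cancel₀ (sub_ne_zero.2 hl), one_smul]
  rw [h0, hrange, finrank_top]
  simp

end Rank

end MiddleConvolution

section RankFormula

open MiddleConvolution Module

/-- **Rank of the middle convolution** [DettweilerReiter2007, Thm. 2.4 (i)] (= [DettweilerReiter2000,
Lemma 2.7]; the algebraic counterpart of Katz's rank formula [Katz1996, Cor. 3.3.6]): for a
finite-dimensional module `(A, V)` over the free group `F_r` on `f₁,…,f_r` (`A_k = ρ(f_k)`) over a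
field `K` and `λ ∈ Kˣ` with `λ ≠ 1`,
`dim MC_λ(V) = Σ_k rk(A_k - 1) - (dim V - rk(λ·A₁⋯A_r - 1))`,
stated as the same identity of natural numbers without subtraction:
`dim MC_λ(V) + dim V = Σ_k rk(A_k - 1) + rk(λ·A₁⋯A_r - 1)`.
[cite: DettweilerReiter2007, Theorem 2.4 (i)] -/
theorem finrank_middleConvolution_add_finrank {K : Type*} [Field K] {V : Type*} [AddCommGroup V]
    [Module K V] [FiniteDimensional K V] {r : ℕ} (ρ : Representation K (FreeGroup (Fin r)) V)
    (l : Kˣ) (hl : (l : K) ≠ 1) :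
    finrank K (Space ρ l) + finrank K V =
      ∑ k, finrank K (LinearMap.range (tuple ρ k - 1)) +
        finrank K (LinearMap.range ((l : K) • ρ (prodGenerators r) - 1)) := by
  cases r with
  | zero => exact finrank_space_add_finrank_zero ρ l hl
  | succ m => exact finrank_space_add_finrank_succ ρ l hl

end RankFormula

/-! ### Named facts: multiplicativity ([DettweilerReiter2007, Thm. 2.4 (ii)]) and the retired
irreducibility statement (Thm. 2.4 (iii), refuted for `r = 0`; corrected and proved in
`Literature.AlgebraicGeometry.Motives.MiddleConvolutionProofs`) -/

namespace MiddleConvolution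

section Conditions

variable {K : Type*} [CommRing K] {V : Type*} [AddCommGroup V] [Module K V] {ι : Type*}

/-- Condition `(*)` of [DettweilerReiter2007, Def. 2.3] on an `F_ι`-module `(A, V)`:
`⋂_{j ≠ i} ker(A_j - 1) ∩ ker(τ A_i - 1) = 0` for every `i` and every `τ ∈ Kˣ` (with `(**)`: `V` has
no `1`-dimensional factor or submodule on which at most one `A_i` acts non-trivially).
[cite: DettweilerReiter2007, Definition 2.3] -/
def CondStar (ρ : Representation K (FreeGroup ι) V) : Prop :=
  ∀ (i : ι) (τ : Kˣ),
    (⨅ j ∈ {j | j ≠ i}, LinearMap.ker (tuple ρ j - 1)) ⊓ LinearMap.ker ((τ : K) • tuple ρ i - 1) = ⊥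

/-- Condition `(**)` of [DettweilerReiter2007, Def. 2.3] on an `F_ι`-module `(A, V)`:
`𝒰_i(τ) := Σ_{j ≠ i} im(A_j - 1) + im(τ A_i - 1)` satisfies `dim 𝒰_i(τ) = dim V`, i.e. (for the
finite-dimensional `V` of the source) `𝒰_i(τ) = V`, for every `i` and every `τ ∈ Kˣ`.
[cite: DettweilerReiter2007, Definition 2.3] -/
def CondStarStar (ρ : Representation K (FreeGroup ι) V) : Prop :=
  ∀ (i : ι) (τ : Kˣ),
    (⨆ j ∈ {j | j ≠ i}, LinearMap.range (tuple ρ j - 1)) ⊔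
      LinearMap.range ((τ : K) • tuple ρ i - 1) = ⊤

end Conditions

end MiddleConvolution

section NamedFacts

open MiddleConvolution

universe v w

/-- **Multiplicativity of `MC_λ`** — NAMED FACT, statement only [DettweilerReiter2007, Thm. 2.4 (ii)]
(= [DettweilerReiter2000, Thm. 3.5]; Katz's `MC_χ̄ ∘ MC_χ ≅ id` on objects with property `P`,
[Katz1996, Thm. 2.9.7], is its geometric counterpart): for a finite-dimensional module `V` over the
free group `F_r` over a field `K` satisfying `(*)` and `(**)`, and `λ₁, λ₂ ∈ Kˣ` with `λ₁λ₂ = λ`,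
`MC_{λ₂}(MC_{λ₁}(V)) ≅ MC_λ(V)` as `F_r`-modules. [cite: DettweilerReiter2007, Theorem 2.4 (ii)] -/
def DettweilerReiter2007_mul : Prop :=
  ∀ (K : Type v) [Field K] (V : Type w) [AddCommGroup V] [Module K V] [FiniteDimensional K V]
    (r : ℕ) (ρ : Representation K (FreeGroup (Fin r)) V) (l₁ l₂ : Kˣ),
    CondStar ρ → CondStarStar ρ →
      Nonempty ((middleConvolution (middleConvolution ρ l₁) l₂).Equiv (middleConvolution ρ (l₁ * l₂)))

/-- **RETIRED — REFUTED AS STATED; not literature debt** (deprecated 2026-08-16; kept only because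
its refutation `not_DettweilerReiter2007_irreducible : ¬ DettweilerReiter2007_irreducible.{0, 0}` in
`Literature.AlgebraicGeometry.Motives.MiddleConvolutionProofs` names it — do not use, do not try to
discharge).

This was the first vendored form of "**`MC_λ` preserves irreducibility**"
[DettweilerReiter2007, Thm. 2.4 (iii)] (= [DettweilerReiter2000, Cor. 3.6]; Katz [Katz1996,
Thm. 2.9.8]; on local systems [Dettweiler2008MC, Cor. 1.12]): for a finite-dimensional module `V`
over `F_r` over a field `K` satisfying `(*)` and `(**)`, if `V` is irreducible then `MC_λ(V)` is
irreducible for every `λ ∈ Kˣ` — but quantified over ALL `r : ℕ`.  **What was wrong:** for `r = 0`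
the statement is false: the `1`-dimensional module of the trivial group `F_0` is irreducible and
satisfies `(*)`, `(**)` vacuously (`CondStar`, `CondStarStar` quantify over `i : Fin 0`), while
`MC_λ(V) = V^0 ⧸ _ = 0` is not irreducible (`Representation.IsIrreducible` excludes the zero module).
The source has `r ≥ 1` throughout ([DettweilerReiter2007, §2.1]: "the free group `F_r` on `r`
generators `f_1, …, f_r`"; the Remark after Def. 2.3 reads `(*)`, `(**)` as excluding the
`1`-dimensional modules on which at most one `A_i` acts non-trivially, which for `r = 0` is every
`1`-dimensional module).

**Use instead** (all in `Literature.AlgebraicGeometry.Motives.MiddleConvolutionProofs`): the corrected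
named fact `DettweilerReiter2007_irreducible_pos` (this statement with the extra hypothesis `0 < r`,
same citation), DISCHARGED by `DettweilerReiter2007_irreducible_pos_holds`, and the theorem
`MiddleConvolution.isIrreducible_middleConvolution` (any nonempty finite ordered index type; only
`(*)` is needed). [cite: DettweilerReiter2007, Theorem 2.4 (iii)] -/
@[deprecated "REFUTED as stated (false for `r = 0`: `not_DettweilerReiter2007_irreducible`); use \
`DettweilerReiter2007_irreducible_pos` (`0 < r`, discharged by \
`DettweilerReiter2007_irreducible_pos_holds`) or `MiddleConvolution.isIrreducible_middleConvolution`, \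
all in `Literature.AlgebraicGeometry.Motives.MiddleConvolutionProofs`" (since := "2026-08-16")]
def DettweilerReiter2007_irreducible : Prop :=
  ∀ (K : Type v) [Field K] (V : Type w) [AddCommGroup V] [Module K V] [FiniteDimensional K V]
    (r : ℕ) (ρ : Representation K (FreeGroup (Fin r)) V) (l : Kˣ),
    CondStar ρ → CondStarStar ρ → ρ.IsIrreducible → (middleConvolution ρ l).IsIrreducible

end NamedFacts

end Literature.AlgebraicGeometry.Motives

end
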